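import Summits.AtomisticToContinuum.Crystallization.Theorems.FrustratedLawDichotomyStrainedPatchHomEntryLeafHTA2QSVerdict
import Summits.AtomisticToContinuum.Crystallization.Theorems.FrustratedLawDichotomyStrainedPatchHomEntrySemanticQuot

/-!
# The SIGN-FREE SHEET LEAF for the orbit-quotient currency `semOKHQ` (27623 `(H) HomFloor (1/625)`, hcp half)

decomp-a2c lens-5 g88, FILE B of NODE 88 (crux `AperiodicFrustratedLawGap`, stmt-AtomisticToContinuum-27623; imports the node
`…HomEntrySemanticQuot`, which lands first).  This is items R1, R2, R6 of the node memo's port recipe, DONE: the production SHEET leaf of record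
(`…HomEntryLeafHTA2QS.entryLeafOKHT4A2QS inner p Q Gn J t`, Boolean UNCHANGED) made available to the quotient currency.

* §0 (R1) `entryLeafOKHQ_sound_noShuf`: the thirteen-disjunct QUICK VERDICT OF RECORD `entryLeafOKHQ μ` is sound WITHOUT shuffle signs off its one
  signed disjunct `shufOut` (tables K1–K4 in vector and class form, the two fits, the radial and column prunes take no sign).
* §1 (R1) the inner Σ-verdict `entryLeafOKHQDCRSQ μ q c w := fitOKHDCRS ∨ fitOKHDM ∨ sectorOut ∨ (!shufOut ∧ entryLeafOKHQ μ)` — the inner verdict of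
  record `entryLeafOKHQDCRS μ q` with the node's VACUOUS sector prune added and the quick table guarded — and its soundness `entryLeafOKHQDCRSQ_sound`
  in the Σ-SHAPE (hypotheses: self-adjoint, `‖U − 1‖ ≤ 1/4`, entry box, shuffle box, `ξ₁ ≤ 0`, `ξ₀² ≤ 3ξ₁²`; NO `ξ₀ / ξ₂` signs); the guard
  `innerGuardQ := !shufOut` and the box-wise implication `entryLeafOKHQDCRSQ_of_guard` (old inner verdict ∧ guard ⇒ new inner verdict).
* §2 (R2) ★★★ `entryLeafOKHT4A2QS_soundQ`: soundness of the UNCHANGED slab Boolean for any inner verdict sound in the Σ-shape, concluding in the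
  Σ-shape — the tree's proof VERBATIM with the two hypothesis TYPES `0 ≤ ξ 0`, `0 ≤ ξ 2` substituted by `ξ 1 ≤ 0`, `(ξ 0)^2 ≤ 3 * (ξ 1)^2` (the slab
  argument only forwards them to the inner point, which is the true shuffle).
* §3 (R6) `entryLeafOKHT4A2QS_of_guard`: an EVALUATED slab certificate over `inner₁` plus the CHEAP guard tree `treeOK (hullInner g J c) t …` gives the
  slab certificate over `inner₂` whenever `inner₁ ∧ g ⇒ inner₂` box-wise (node §4b `treeOK_of_guard`) — old cells are re-validated, not re-evaluated.
* §4 ★ `semOKHQ_of_A2QSQ`: explicit payloads `(q, p, Q, Gn, J, t)` passing `entryLeafOKHT4A2QS (entryLeafOKHQDCRSQ μ q) p Q Gn J t c w` make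
  `semOKHQ μ c w` (node §4b `semOKHQ_of_sound`); `semOKHQ_of_A2QS_guard`: the same from an OLD-inner certificate plus its guard tree.

Kernel definitions + soundness; complete proofs, no placeholders; standard axioms; additive (nothing landed is modified); only the tiny §5 smoke examples are
kernel-evaluated.  `--supports stmt-AtomisticToContinuum-27623`.
-/

noncomputable section

/-! ## §0. The quick verdict of record is sign-free off its `shufOut` disjunct (R1) -/

namespace Summit.AtomisticToContinuum.Crystallization.Theorems.FrustratedLawDichotomyStrainedPatchHomLeafTableCheckHcpV

open scoped BigOperators RealInnerProductSpace
open Literature.Analysis.ValidatedNumerics.Numerics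
open Summit.AtomisticToContinuum.Crystallization.Theorems.ChargedEnergyGapNegative (E3)
open Summit.AtomisticToContinuum.Crystallization.Theorems.FrustratedLawDichotomySchurCut (effPot w₄₅ ω₄)
open Summit.AtomisticToContinuum.Crystallization.Theorems.FrustratedLawDichotomyAveragingRuleTightFree (TightNearCap BadNearCap)
open Summit.AtomisticToContinuum.Crystallization.Theorems.FrustratedLawDichotomyExemptAbsorption (ExemptNear)
open Summit.AtomisticToContinuum.Crystallization.Theorems.FrustratedLawDichotomyStrainedPatchHomSplit (ExRec latPt hexFrame hcpShift)
open Summit.AtomisticToContinuum.Crystallization.Theorems.FrustratedLawDichotomyStrainedPatchHomEntrySymBox (hbox_symU)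
open Summit.AtomisticToContinuum.Crystallization.Theorems.FrustratedLawDichotomyStrainedPatchHomEntryFlipHcp (shufOut)
open Summit.AtomisticToContinuum.Crystallization.Theorems.FrustratedLawDichotomyStrainedPatchHomLeafTableCheck (qTableK1_allOKK qTableK2_allOKK qTableK3_allOKK qTableK4_allOKK)
open Summit.AtomisticToContinuum.Crystallization.Theorems.FrustratedLawDichotomyStrainedPatchHomLeafTableCheckHcp (tabSem_of_allOKK)
open Summit.AtomisticToContinuum.Crystallization.Theorems.FrustratedLawDichotomyStrainedPatchHomEntryTableHcp (entryLeafOKHTW tableLeafOKHW_sound)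
open Summit.AtomisticToContinuum.Crystallization.Theorems.FrustratedLawDichotomyStrainedPatchHomEntryQuickHcp (entryLeafOKHQ)
open Summit.AtomisticToContinuum.Crystallization.Theorems.FrustratedLawDichotomyStrainedPatchHomEntryGram (false_of_colOutOK)
open Summit.AtomisticToContinuum.Crystallization.Theorems.FrustratedLawDichotomyStrainedPatchHomEntryRadialHcp (radOKH_sound)
open Summit.AtomisticToContinuum.Crystallization.Theorems.FrustratedLawDichotomyStrainedPatchHomEntryFitHcp (fitOKH_sound)
open Summit.AtomisticToContinuum.Crystallization.Theorems.FrustratedLawDichotomyStrainedPatchHomEntryFitHcpSharp (fitOKHS_sound)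

/-- ★ (R1) **THE QUICK VERDICT OF RECORD `entryLeafOKHQ μ` IS SOUND WITHOUT SHUFFLE SIGNS OFF ITS `shufOut` DISJUNCT**: of its thirteen disjuncts only
the shuffle-sign prune uses `0 ≤ ξ₀, 0 ≤ ξ₂`; the vector-form and class tables K1–K4, the two fits, the radial prune and the column prune are sound for
every admissible `(U, ξ)` of the box. [folklore chaining: the dispatch of `entryLeafOKHVK_sound` / `entryLeafOKH3RDTK_sound` with the `shufOut` branch
closed by the guard] -/
theorem entryLeafOKHQ_sound_noShuf {μ : ℤ} {c w : (Fin 3 × Fin 3) ⊕ Fin 3 → ℤ} (h : entryLeafOKHQ μ c w = true) (hs : shufOut c w = false)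
    (U : E3 →L[ℝ] E3) (ξ : E3) (hsa : ∀ v v' : E3, ⟪U v, v'⟫ = ⟪v, U v'⟫) (hU : ‖U - 1‖ ≤ 1 / 4)
    (hbox : ∀ ab : Fin 3 × Fin 3, |(U (EuclideanSpace.single ab.2 (1 : ℝ))) ab.1 - (c (Sum.inl ab) : ℝ) / SC| ≤ (w (Sum.inl ab) : ℝ) / SC)
    (hξ : ∀ i : Fin 3, |ξ i - (c (Sum.inr i) : ℝ) / SC| ≤ (w (Sum.inr i) : ℝ) / SC) :
    (∀ (M : ℕ) (z : Fin M → E3) (cc : Fin M), Function.Injective z →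
        Set.range z = {x : E3 | dist x (z cc) ≤ 133 / 10 ∧ ∃ a : Fin 3 → ℤ,
          x = z cc + latPt U hexFrame a ∨ x = z cc + latPt U hexFrame a + U (hcpShift + ξ)} →
        TightNearCap (9 / 5) (3 / 2) z cc ∨ ExemptNear (9 / 5) ExRec z cc ∨ BadNearCap (9 / 5) (3 / 2) z cc) ∨
      (μ : ℝ) / SC ≤ ∑ b ∈ (Fintype.piFinset fun _ : Fin 3 => Finset.Icc (-7 : ℤ) 7).filter (fun b => b ≠ 0), effPot w₄₅ ω₄ (3 / 400) ‖latPt U hexFrame b‖ +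
        ∑ b ∈ (Fintype.piFinset fun _ : Fin 3 => Finset.Icc (-7 : ℤ) 7), effPot w₄₅ ω₄ (3 / 400) ‖latPt U hexFrame b + U (hcpShift + ξ)‖ := by
  simp only [entryLeafOKHQ, entryLeafOKHVT, entryLeafOKHTW, Bool.or_eq_true] at h
  rcases h with (((((((((((h | h) | h) | h) | h) | h) | h) | h) | h) | h) | h) | h) | h
  · rw [hs] at h; exact (Bool.false_ne_true h).elim
  · exact tableLeafOKHV_sound (tabSem_of_allOKK qTableK1_allOKK) h U ξ hsa hU (hbox_symU hsa hbox) hξ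
  · exact tableLeafOKHV_sound (tabSem_of_allOKK qTableK2_allOKK) h U ξ hsa hU (hbox_symU hsa hbox) hξ
  · exact tableLeafOKHV_sound (tabSem_of_allOKK qTableK3_allOKK) h U ξ hsa hU (hbox_symU hsa hbox) hξ
  · exact tableLeafOKHV_sound (tabSem_of_allOKK qTableK4_allOKK) h U ξ hsa hU (hbox_symU hsa hbox) hξ
  · exact Or.inl (fitOKHS_sound h U ξ hU (hbox_symU hsa hbox) hξ)
  · exact Or.inl (fitOKH_sound h U ξ hU (hbox_symU hsa hbox) hξ)
  · exact tableLeafOKHW_sound (tabSem_of_allOKK qTableK1_allOKK) h U ξ hsa hU (hbox_symU hsa hbox) hξ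
  · exact tableLeafOKHW_sound (tabSem_of_allOKK qTableK2_allOKK) h U ξ hsa hU (hbox_symU hsa hbox) hξ
  · exact tableLeafOKHW_sound (tabSem_of_allOKK qTableK3_allOKK) h U ξ hsa hU (hbox_symU hsa hbox) hξ
  · exact tableLeafOKHW_sound (tabSem_of_allOKK qTableK4_allOKK) h U ξ hsa hU (hbox_symU hsa hbox) hξ
  · exact Or.inl (radOKH_sound h U ξ hU (hbox_symU hsa hbox) hξ)
  · exact (false_of_colOutOK h U hU (hbox_symU hsa hbox)).elim

end Summit.AtomisticToContinuum.Crystallization.Theorems.FrustratedLawDichotomyStrainedPatchHomLeafTableCheckHcpV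

/-! ## §1. The inner Σ-verdict (R1) -/

namespace Summit.AtomisticToContinuum.Crystallization.Theorems.FrustratedLawDichotomyStrainedPatchHomEntryFitHcpCentred

open scoped BigOperators RealInnerProductSpace
open Literature.Analysis.ValidatedNumerics.Numerics
open Summit.AtomisticToContinuum.Crystallization.Theorems.ChargedEnergyGapNegative (E3)
open Summit.AtomisticToContinuum.Crystallization.Theorems.FrustratedLawDichotomySchurCut (effPot w₄₅ ω₄)
open Summit.AtomisticToContinuum.Crystallization.Theorems.FrustratedLawDichotomyAveragingRuleTightFree (TightNearCap BadNearCap)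
open Summit.AtomisticToContinuum.Crystallization.Theorems.FrustratedLawDichotomyExemptAbsorption (ExemptNear)
open Summit.AtomisticToContinuum.Crystallization.Theorems.FrustratedLawDichotomyStrainedPatchHomSplit (ExRec latPt hexFrame hcpShift)
open Summit.AtomisticToContinuum.Crystallization.Theorems.FrustratedLawDichotomyStrainedPatchHomEntrySymBox (symH hbox_symU)
open Summit.AtomisticToContinuum.Crystallization.Theorems.FrustratedLawDichotomyStrainedPatchHomEntryQuickHcp (entryLeafOKHQ)
open Summit.AtomisticToContinuum.Crystallization.Theorems.FrustratedLawDichotomyStrainedPatchHomEntryFlipHcp (shufOut)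
open Summit.AtomisticToContinuum.Crystallization.Theorems.FrustratedLawDichotomyStrainedPatchHomLeafTableCheckHcpV (entryLeafOKHQ_sound_noShuf)
open Summit.AtomisticToContinuum.Crystallization.Theorems.FrustratedLawDichotomyStrainedPatchHomEntrySemanticQuot (sectorOut false_of_sectorOut)

/-- ★ (R1) **THE INNER Σ-VERDICT**: the inner verdict of record `entryLeafOKHQDCRS μ q` (squared centred-rotated pair fit ∨ min-pairs fit ∨ quick table)
with the vacuous SECTOR prune of the quotient added and the quick table of record GUARDED by `!shufOut` (its only signed disjunct switched off) — the full
power of the inner verdict of record minus the shuffle-sign prune, plus the sector prune. -/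
def entryLeafOKHQDCRSQ (μ : ℤ) (q : Fin 4 → ℤ) (c w : (Fin 3 × Fin 3) ⊕ Fin 3 → ℤ) : Bool :=
  fitOKHDCRS (symH c) (symH w) q || fitOKHDM (symH c) (symH w) || sectorOut c w || (!(shufOut c w) && entryLeafOKHQ μ c w)

/-- ★ Soundness of the inner Σ-verdict in the Σ-SHAPE (no shuffle signs). [folklore chaining: `fitOKHDCRS_sound` / `fitOKHDM_sound` take no sign;
the sector disjunct is vacuous by `false_of_sectorOut`; the guarded quick table by §0] -/
theorem entryLeafOKHQDCRSQ_sound {μ : ℤ} {q : Fin 4 → ℤ} (c w : (Fin 3 × Fin 3) ⊕ Fin 3 → ℤ) (h : entryLeafOKHQDCRSQ μ q c w = true) (U : E3 →L[ℝ] E3) (ξ : E3)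
    (hsa : ∀ v v' : E3, ⟪U v, v'⟫ = ⟪v, U v'⟫) (hU : ‖U - 1‖ ≤ 1 / 4)
    (hbox : ∀ ab : Fin 3 × Fin 3, |(U (EuclideanSpace.single ab.2 (1 : ℝ))) ab.1 - (c (Sum.inl ab) : ℝ) / SC| ≤ (w (Sum.inl ab) : ℝ) / SC)
    (hξ : ∀ i : Fin 3, |ξ i - (c (Sum.inr i) : ℝ) / SC| ≤ (w (Sum.inr i) : ℝ) / SC) (hb : ξ 1 ≤ 0) (hab : (ξ 0) ^ 2 ≤ 3 * (ξ 1) ^ 2) :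
    (∀ (M : ℕ) (z : Fin M → E3) (cc : Fin M), Function.Injective z →
        Set.range z = {x : E3 | dist x (z cc) ≤ 133 / 10 ∧ ∃ a : Fin 3 → ℤ,
          x = z cc + latPt U hexFrame a ∨ x = z cc + latPt U hexFrame a + U (hcpShift + ξ)} →
        TightNearCap (9 / 5) (3 / 2) z cc ∨ ExemptNear (9 / 5) ExRec z cc ∨ BadNearCap (9 / 5) (3 / 2) z cc) ∨
      (μ : ℝ) / SC ≤ ∑ b ∈ (Fintype.piFinset fun _ : Fin 3 => Finset.Icc (-7 : ℤ) 7).filter (fun b => b ≠ 0), effPot w₄₅ ω₄ (3 / 400) ‖latPt U hexFrame b‖ +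
        ∑ b ∈ (Fintype.piFinset fun _ : Fin 3 => Finset.Icc (-7 : ℤ) 7), effPot w₄₅ ω₄ (3 / 400) ‖latPt U hexFrame b + U (hcpShift + ξ)‖ := by
  simp only [entryLeafOKHQDCRSQ, Bool.or_eq_true, Bool.and_eq_true, Bool.not_eq_true'] at h
  rcases h with ((h | h) | h) | ⟨hs, h⟩
  · exact Or.inl (fitOKHDCRS_sound h U ξ hsa hU (hbox_symU hsa hbox) hξ)
  · exact Or.inl (fitOKHDM_sound h U ξ hsa hU (hbox_symU hsa hbox) hξ)
  · exact (false_of_sectorOut h hξ hb hab).elim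
  · exact entryLeafOKHQ_sound_noShuf h hs U ξ hsa hU hbox hξ

/-- (R6) THE GUARD for re-validating an inner tree evaluated with the OLD inner verdict: «the shuffle-sign prune does not fire on the box» — one
sign test per inner box, no fit test re-run. -/
def innerGuardQ (c w : (Fin 3 × Fin 3) ⊕ Fin 3 → ℤ) : Bool := !(shufOut c w)

/-- Box-wise: old inner verdict ∧ guard ⇒ inner Σ-verdict. [formal bookkeeping] -/
theorem entryLeafOKHQDCRSQ_of_guard (μ : ℤ) (q : Fin 4 → ℤ) (c w : (Fin 3 × Fin 3) ⊕ Fin 3 → ℤ) (h : entryLeafOKHQDCRS μ q c w = true)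
    (hg : innerGuardQ c w = true) : entryLeafOKHQDCRSQ μ q c w = true := by
  simp only [entryLeafOKHQDCRS, Bool.or_eq_true] at h
  simp only [entryLeafOKHQDCRSQ, Bool.or_eq_true, Bool.and_eq_true]
  rcases h with (hfit | hfit) | hq
  · exact Or.inl (Or.inl (Or.inl hfit))
  · exact Or.inl (Or.inl (Or.inr hfit))
  · exact Or.inr ⟨hg, hq⟩

end Summit.AtomisticToContinuum.Crystallization.Theorems.FrustratedLawDichotomyStrainedPatchHomEntryFitHcpCentred

/-! ## §2. The slab leaf of record, sound in the Σ-shape (R2) -/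

namespace Summit.AtomisticToContinuum.Crystallization.Theorems.FrustratedLawDichotomyStrainedPatchHomEntryLeafHT

open scoped BigOperators RealInnerProductSpace
open Literature.Analysis.ValidatedNumerics.Numerics
open Summit.AtomisticToContinuum.Crystallization.Theorems.ChargedEnergyGapNegative (E3)
open Summit.AtomisticToContinuum.Crystallization.Theorems.FrustratedLawDichotomySchurCut (effPot w₄₅ ω₄)
open Summit.AtomisticToContinuum.Crystallization.Theorems.FrustratedLawDichotomyAveragingRuleTightFree (TightNearCap BadNearCap)
open Summit.AtomisticToContinuum.Crystallization.Theorems.FrustratedLawDichotomyExemptAbsorption (ExemptNear)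
open Summit.AtomisticToContinuum.Crystallization.Theorems.FrustratedLawDichotomyStrainedPatchHomSplit (ExRec latPt hexFrame hcpShift HomFloor)
open Summit.AtomisticToContinuum.Crystallization.Theorems.FrustratedLawDichotomyStrainedPatchTaylorChord (segGd)
open Summit.AtomisticToContinuum.Crystallization.Theorems.FrustratedLawDichotomyStrainedPatchHomCurvCentreKit (cenShuf cenShuf_apply)
open Summit.AtomisticToContinuum.Crystallization.Theorems.FrustratedLawDichotomyStrainedPatchHomCurvLeaf
  (nodup_filter_append toFinset_filter_append)
open Summit.AtomisticToContinuum.Crystallization.Theorems.FrustratedLawDichotomyStrainedPatchHomCurvLJ (isCenLJ curvCheckLJM naiveLJ ljLabelOK)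
open Summit.AtomisticToContinuum.Crystallization.Theorems.FrustratedLawDichotomyStrainedPatchHomForceJacN
  (fjQ forceJacCheckN boxLabels11 boxLabels11_toFinset boxLabels11_nodup)
open Summit.AtomisticToContinuum.Crystallization.Theorems.FrustratedLawDichotomyStrainedPatchHomSlopeLJ
  (slopeLJLabelOK slopeCheckLJ slopeGsLJ slopeCheckLJ_slopeGsLJ forceLJ_ref_bound_of_check)
open Summit.AtomisticToContinuum.Crystallization.Theorems.FrustratedLawDichotomyStrainedPatchHomSlopeLJAffine
open Summit.AtomisticToContinuum.Crystallization.Theorems.FrustratedLawDichotomyStrainedPatchHomSlopeLJAffine2Kit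
open Summit.AtomisticToContinuum.Crystallization.Theorems.FrustratedLawDichotomyStrainedPatchHomSlopeLJAffine2Q
open Summit.AtomisticToContinuum.Crystallization.Theorems.FrustratedLawDichotomyStrainedPatchHomSlopeLJThirdSharp (slopeCheckLJA2QS)
open Summit.AtomisticToContinuum.Crystallization.Theorems.FrustratedLawDichotomyStrainedPatchHomSlopeLJAffine2QS
open Summit.AtomisticToContinuum.Crystallization.Theorems.FrustratedLawDichotomyStrainedPatchHomForceHcp (xiBallOK norm_le_quarter_of_xiBallOK)
open Summit.AtomisticToContinuum.Crystallization.Theorems.FrustratedLawDichotomyStrainedPatchHomSlabConfine (abs_apply_le_of_qcert)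
open Summit.AtomisticToContinuum.Crystallization.Theorems.FrustratedLawDichotomyStrainedPatchHomSlabLeaf
  (jac_floorM_of_three_checks abs_coord_le_of_confined hver_of_slabParts)
open Summit.AtomisticToContinuum.Crystallization.Theorems.FrustratedLawDichotomyStrainedPatchHomEntryFitHcpCentred
  (entryLeafOKHQDCRS entryLeafOKHQDCRSQ entryLeafOKHQDCRSQ_sound innerGuardQ entryLeafOKHQDCRSQ_of_guard)
open Summit.AtomisticToContinuum.Crystallization.Theorems.FrustratedLawDichotomyStrainedPatchHomCertTree (CertTree treeOK treeOK_sound)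
open Summit.AtomisticToContinuum.Crystallization.Theorems.FrustratedLawDichotomyStrainedPatchHomEntrySemanticQuot (semOKHQ semOKHQ_of_sound treeOK_of_guard sectorOut rootCHQ rootWHQ)
open Summit.AtomisticToContinuum.Crystallization.Theorems.FrustratedLawDichotomyStrainedPatchHomEntryFlipHcp (shufOut)

/-- ★★★ **SOUNDNESS OF THE (UNCHANGED) SLAB LEAF `entryLeafOKHT4A2QS` IN THE QUOTIENT (Σ-) SHAPE, FOR ANY INNER VERDICT SOUND IN THE Σ-SHAPE.**
The Boolean is the tree's; only the semantic shape of `inner` and of the conclusion's hypotheses changes: the two shuffle SIGNS `0 ≤ ξ₀, 0 ≤ ξ₂` are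
REPLACED by the two SECTOR hypotheses `ξ₁ ≤ 0, ξ₀² ≤ 3ξ₁²`, which the slab argument merely forwards to the inner tree (the true shuffle `η = ξ` is the
inner point).  [folklore chaining: the proof of `…HomEntryLeafHTA2QS.entryLeafOKHT4A2QS_sound` VERBATIM with the two hypothesis types substituted] -/
theorem entryLeafOKHT4A2QS_soundQ {μ : ℤ} {inner : ((Fin 3 × Fin 3) ⊕ Fin 3 → ℤ) → ((Fin 3 × Fin 3) ⊕ Fin 3 → ℤ) → Bool}
    (hinner : ∀ c w, inner c w = true → ∀ (U : E3 →L[ℝ] E3) (ξ : E3), (∀ v v' : E3, ⟪U v, v'⟫ = ⟪v, U v'⟫) → ‖U - 1‖ ≤ 1 / 4 →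
      (∀ ab : Fin 3 × Fin 3, |(U (EuclideanSpace.single ab.2 (1 : ℝ))) ab.1 - (c (Sum.inl ab) : ℝ) / SC| ≤ (w (Sum.inl ab) : ℝ) / SC) →
      (∀ i : Fin 3, |ξ i - (c (Sum.inr i) : ℝ) / SC| ≤ (w (Sum.inr i) : ℝ) / SC) → ξ 1 ≤ 0 → (ξ 0) ^ 2 ≤ 3 * (ξ 1) ^ 2 →
      (∀ (M : ℕ) (z : Fin M → E3) (cc : Fin M), Function.Injective z →
          Set.range z = {x : E3 | dist x (z cc) ≤ 133 / 10 ∧ ∃ a : Fin 3 → ℤ,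
            x = z cc + latPt U hexFrame a ∨ x = z cc + latPt U hexFrame a + U (hcpShift + ξ)} →
          TightNearCap (9 / 5) (3 / 2) z cc ∨ ExemptNear (9 / 5) ExRec z cc ∨ BadNearCap (9 / 5) (3 / 2) z cc) ∨
        (μ : ℝ) / SC ≤ ∑ b ∈ (Fintype.piFinset fun _ : Fin 3 => Finset.Icc (-7 : ℤ) 7).filter (fun b => b ≠ 0), effPot w₄₅ ω₄ (3 / 400) ‖latPt U hexFrame b‖ +
          ∑ b ∈ (Fintype.piFinset fun _ : Fin 3 => Finset.Icc (-7 : ℤ) 7), effPot w₄₅ ω₄ (3 / 400) ‖latPt U hexFrame b + U (hcpShift + ξ)‖)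
    {p : HTCert} {Q : Fin 3 → ℤ} {Gn : ℤ} {J : Fin 3 → Fin 3 × Fin 3 → ℤ} {t : CertTree ((Fin 3 × Fin 3) ⊕ Fin 3)} {c w : (Fin 3 × Fin 3) ⊕ Fin 3 → ℤ}
    (h : entryLeafOKHT4A2QS inner p Q Gn J t c w = true) (U : E3 →L[ℝ] E3) (ξ : E3)
    (hsa : ∀ v v' : E3, ⟪U v, v'⟫ = ⟪v, U v'⟫) (hU : ‖U - 1‖ ≤ 1 / 4)
    (hbox : ∀ ab : Fin 3 × Fin 3, |(U (EuclideanSpace.single ab.2 (1 : ℝ))) ab.1 - (c (Sum.inl ab) : ℝ) / SC| ≤ (w (Sum.inl ab) : ℝ) / SC)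
    (hξ : ∀ i : Fin 3, |ξ i - (c (Sum.inr i) : ℝ) / SC| ≤ (w (Sum.inr i) : ℝ) / SC) (hb : ξ 1 ≤ 0) (hab : (ξ 0) ^ 2 ≤ 3 * (ξ 1) ^ 2) :
    (∀ (M : ℕ) (z : Fin M → E3) (cc : Fin M), Function.Injective z →
        Set.range z = {x : E3 | dist x (z cc) ≤ 133 / 10 ∧ ∃ a : Fin 3 → ℤ,
          x = z cc + latPt U hexFrame a ∨ x = z cc + latPt U hexFrame a + U (hcpShift + ξ)} →
        TightNearCap (9 / 5) (3 / 2) z cc ∨ ExemptNear (9 / 5) ExRec z cc ∨ BadNearCap (9 / 5) (3 / 2) z cc) ∨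
      (μ : ℝ) / SC ≤ ∑ b ∈ (Fintype.piFinset fun _ : Fin 3 => Finset.Icc (-7 : ℤ) 7).filter (fun b => b ≠ 0), effPot w₄₅ ω₄ (3 / 400) ‖latPt U hexFrame b‖ +
        ∑ b ∈ (Fintype.piFinset fun _ : Fin 3 => Finset.Icc (-7 : ℤ) 7), effPot w₄₅ ω₄ (3 / 400) ‖latPt U hexFrame b + U (hcpShift + ξ)‖ := by
  classical
  have hS : (0 : ℝ) < SC := by norm_num [SC]
  unfold entryLeafOKHT4A2QS htCertSideA2QS at h
  simp only [Bool.and_eq_true, decide_eq_true_eq] at h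
  obtain ⟨⟨⟨⟨⟨⟨⟨⟨⟨hball, hjac⟩, hROK⟩, hcert⟩, hcurvM⟩, hfar1⟩, hfar2⟩, ⟨⟨hs1, hs2⟩, hs3⟩⟩, hGs⟩, htree⟩ := h
  obtain ⟨hKlt, hT, hγ, hr, hconf⟩ := htCertOKU_spec hcert
  -- the reference shuffle: the AFFINE (sheet-tracking) reference at `U`
  set ξ₀ : E3 := affShuf J c U with hξ₀def
  have hw0 : ∀ i : Fin 3, (0 : ℝ) ≤ (w (Sum.inr i) : ℝ) / SC := fun i => (abs_nonneg _).trans (hξ i)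
  have hξ₀box : ∀ i : Fin 3, |ξ₀ i - (c (Sum.inr i) : ℝ) / SC| ≤ (w (Sum.inr i) : ℝ) / SC := by
    intro i
    refine (abs_affShuf_sub_le (J := J) (w := w) U hbox i).trans ?_
    rw [div_le_div_iff_of_pos_right hS]
    exact_mod_cast jacOK_spec hjac i
  have hn : ‖ξ‖ ≤ 1 / 4 := norm_le_quarter_of_xiBallOK hball hξ
  have hn₀ : ‖ξ₀‖ ≤ 1 / 4 := norm_le_quarter_of_xiBallOK hball hξ₀box
  -- label finsets
  set B : Finset (Fin 3 → ℤ) := (htBU c w).toFinset with hBdef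
  set R : Finset (Fin 3 → ℤ) := (htRU c w).toFinset with hRdef
  have hB : B ⊆ Fintype.piFinset fun _ : Fin 3 => Finset.Icc (-11 : ℤ) 11 := by
    intro b hb
    rw [← boxLabels11_toFinset]
    exact List.mem_toFinset.2 (mem_boxLabels11_of_mem_htUniv (mem_htUniv_of_mem_htBU (List.mem_toFinset.1 hb)))
  have hBin : ∀ bb ∈ B, ‖latPt U hexFrame bb + U (hcpShift + ξ)‖ ≤ 7 :=
    fun bb hbb => norm_le_seven_of_htIn U hbox ξ hξ (htIn_of_mem_htBU (List.mem_toFinset.1 hbb))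
  have hR : ∀ bb ∈ (Fintype.piFinset fun _ : Fin 3 => Finset.Icc (-11 : ℤ) 11) \ B, ‖latPt U hexFrame bb + U (hcpShift + ξ)‖ ≤ 7 →
      bb ∈ R ∧ 6 ≤ ‖latPt U hexFrame bb + U (hcpShift + ξ)‖ := by
    intro bb hbb h7
    obtain ⟨hbox11, hnotB⟩ := Finset.mem_sdiff.1 hbb
    rw [← boxLabels11_toFinset] at hbox11
    have hbL : bb ∈ boxLabels11 := List.mem_toFinset.1 hbox11
    have hlo := lo_le_of_norm_le_seven U hbox ξ hξ h7
    by_cases huniv : bb ∈ htUniv c w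
    swap
    · exact absurd h7 (not_le.2 (seven_lt_norm_of_not_mem_htUniv U hbox hξ hKlt hbL huniv))
    by_cases hin : htIn c w bb = true
    · exact absurd (List.mem_toFinset.2 (mem_htBU_of_htIn huniv hin)) hnotB
    · have hmemR : bb ∈ htRU c w := by
        refine List.mem_filter.2 ⟨huniv, ?_⟩
        simp only [Bool.and_eq_true, Bool.not_eq_true', decide_eq_true_eq]
        exact ⟨by simpa using hin, hlo⟩
      have h36 : 36 * (SC : ℤ) ≤ (fjQ c w bb).lo := by
        have := List.all_eq_true.1 hROK bb hmemR
        simpa using this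
      exact ⟨List.mem_toFinset.2 hmemR, six_le_norm_of_lo U hbox ξ hξ h36⟩
  -- the Q-floor along the segment
  have hcurv : ∀ s ∈ Set.Ioo (0 : ℝ) 1,
      ((p.lam₁ + p.lam₂ + p.lam₃ : ℤ) : ℝ) / SC * ‖U (ξ - ξ₀)‖ ^ 2 + ∑ i : Fin 3, ∑ j : Fin 3, (p.D i j : ℝ) / SC * ((U (ξ - ξ₀)) i * (U (ξ - ξ₀)) j) ≤
        ∑ bb ∈ B, segGd (fun x : ℝ => x⁻¹ ^ 7 - x⁻¹ ^ 13) (latPt U hexFrame bb + U (hcpShift + ξ₀)) (U (ξ - ξ₀)) s :=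
    fun s hs => jac_floorM_of_three_checks (htBU_nodup c w) hcurvM hfar1 hfar2 U hU hbox ξ₀ ξ hξ₀box hξ hn₀ hn hs
  -- the reference force bound ALONG THE AFFINE REFERENCE, chunked
  have hf₀ : |∑ bb ∈ B, (‖latPt U hexFrame bb + U (hcpShift + ξ₀)‖⁻¹ ^ 8 - ‖latPt U hexFrame bb + U (hcpShift + ξ₀)‖⁻¹ ^ 14) *
      ⟪latPt U hexFrame bb + U (hcpShift + ξ₀), U (ξ - ξ₀)⟫| ≤ (p.Gs : ℝ) / SC * ‖U (ξ - ξ₀)‖ := by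
    have key := refForce_htBU_leA2QS hs1 hs2 hs3 U hU hbox hn₀ ξ
    refine key.trans (mul_le_mul_of_nonneg_right ?_ (norm_nonneg _))
    rw [div_le_div_iff_of_pos_right hS]
    exact_mod_cast hGs
  -- slab ⟹ confinement ⟹ the inner verdict on the sheet-tracked confined box
  have hslab : ((p.lam₁ + p.lam₂ + p.lam₃ : ℤ) : ℝ) / SC * ‖U (ξ - ξ₀)‖ ^ 2 +
        ∑ i : Fin 3, ∑ j : Fin 3, (p.D i j : ℝ) / SC * ((U (ξ - ξ₀)) i * (U (ξ - ξ₀)) j) ≤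
      ((6000 / 343 * (7 : ℝ)⁻¹ ^ 4 + 2880 / 49 * (7 : ℝ)⁻¹ ^ 5 + 10 / 7 * (7 : ℝ)⁻¹ ^ 6 + 2 * (7 : ℝ)⁻¹ ^ 7) + (p.Gs : ℝ) / SC +
        R.card * (6 : ℝ)⁻¹ ^ 7) * ‖U (ξ - ξ₀)‖ →
      (∀ (M : ℕ) (z : Fin M → E3) (cc : Fin M), Function.Injective z →
          Set.range z = {x : E3 | dist x (z cc) ≤ 133 / 10 ∧ ∃ a : Fin 3 → ℤ,
            x = z cc + latPt U hexFrame a ∨ x = z cc + latPt U hexFrame a + U (hcpShift + ξ)} →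
          TightNearCap (9 / 5) (3 / 2) z cc ∨ ExemptNear (9 / 5) ExRec z cc ∨ BadNearCap (9 / 5) (3 / 2) z cc) ∨
        (μ : ℝ) / SC ≤ ∑ b ∈ (Fintype.piFinset fun _ : Fin 3 => Finset.Icc (-7 : ℤ) 7).filter (fun b => b ≠ 0), effPot w₄₅ ω₄ (3 / 400) ‖latPt U hexFrame b‖ +
          ∑ b ∈ (Fintype.piFinset fun _ : Fin 3 => Finset.Icc (-7 : ℤ) 7), effPot w₄₅ ω₄ (3 / 400) ‖latPt U hexFrame b + U (hcpShift + ξ)‖ := by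
    intro hq
    have ht0 : (0 : ℝ) < (htTU p c w : ℝ) / SC := div_pos (by exact_mod_cast hT) hS
    have hle := slabConst_le_htTU p c w
    have hQ : (p.lamT : ℝ) / SC * ‖U (ξ - ξ₀)‖ ^ 2 + ∑ i : Fin 3, ∑ j : Fin 3, (p.D i j : ℝ) / SC * ((U (ξ - ξ₀)) i * (U (ξ - ξ₀)) j) ≤
        (htTU p c w : ℝ) / SC * ‖U (ξ - ξ₀)‖ := by
      have e : (p.lamT : ℝ) = ((p.lam₁ + p.lam₂ + p.lam₃ : ℤ) : ℝ) := by simp [HTCert.lamT]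
      rw [e]
      exact hq.trans (mul_le_mul_of_nonneg_right hle (norm_nonneg _))
    have hΔk : ∀ k : Fin 3, |(U (ξ - ξ₀)) k| ≤ (p.rS k : ℝ) / SC := fun k =>
      abs_apply_le_of_qcert (Q := fun x : E3 => (p.lamT : ℝ) / SC * ‖x‖ ^ 2 + ∑ i : Fin 3, ∑ j : Fin 3, (p.D i j : ℝ) / SC * (x i * x j))
        ht0 (div_pos (by exact_mod_cast hγ k) hS) (div_nonneg (by exact_mod_cast hr k) hS.le) k (fun x => htConfU_sound (hconf k) x) hQ
    have hy := fun k => abs_coord_le_of_confined hU (ξ - ξ₀) (r := fun j => (p.rS j : ℝ) / SC) (κ := fun k => (htκ c w k : ℝ) / SC) hΔk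
      (rowDev_le U hbox) k
    -- the sheet-tracked confined box: `ζ = ξ − ξ₀(U)` recentred at `ξ_c`
    have hζ : ∀ i : Fin 3, |((c (Sum.inr i) : ℝ) / SC + (ξ - ξ₀) i) - (c (Sum.inr i) : ℝ) / SC| ≤ (htW p c w (Sum.inr i) : ℝ) / SC := by
      intro i
      rw [add_sub_cancel_left]
      refine (hy i).trans ?_
      rw [htW_inr]
      have hρ := sqrt_le_htρ p
      have hκ0 : (0 : ℝ) ≤ (htκ c w i : ℝ) / SC :=
        (Finset.sum_nonneg fun j _ => abs_nonneg _).trans (rowDev_le U hbox i)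
      have hcd := div_le_cdiv (a := htκ c w i * 4 * htρ p) (b := 3 * (SC : ℤ)) (by norm_num [SC])
      have step : (htκ c w i : ℝ) / SC * (4 / 3 * Real.sqrt (∑ j : Fin 3, ((p.rS j : ℝ) / SC) ^ 2)) ≤
          ((cdiv (htκ c w i * 4 * htρ p) (3 * SC) : ℤ) : ℝ) / SC := by
        have h1 : (htκ c w i : ℝ) / SC * (4 / 3 * Real.sqrt (∑ j : Fin 3, ((p.rS j : ℝ) / SC) ^ 2)) ≤
            (htκ c w i : ℝ) / SC * (4 / 3 * ((htρ p : ℝ) / SC)) := by gcongr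
        refine h1.trans ?_
        rw [le_div_iff₀ hS]
        have e : (htκ c w i : ℝ) / SC * (4 / 3 * ((htρ p : ℝ) / SC)) * SC = ((htκ c w i * 4 * htρ p : ℤ) : ℝ) / ((3 * (SC : ℤ) : ℤ) : ℝ) := by
          push_cast; field_simp
        rw [e]; exact hcd
      push_cast
      rw [add_div]
      linarith
    -- the tree point `(U_ab, ξ_c,i + ζ_i)` lies in the rounded confined box; run the inner certificate tree there
    have hx : ∀ k, |(Sum.elim (fun ab : Fin 3 × Fin 3 => (U (EuclideanSpace.single ab.2 (1 : ℝ))) ab.1)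
        (fun i : Fin 3 => (c (Sum.inr i) : ℝ) / SC + (ξ - ξ₀) i) k) - (c k : ℝ) / SC| ≤ (htWr p c w k : ℝ) / SC := by
      intro k
      rcases k with ab | i
      · exact hbox ab
      · refine (hζ i).trans ?_
        rw [div_le_div_iff_of_pos_right hS]
        exact_mod_cast htW_le_htWr p c w i
    have key := treeOK_sound SC_pos
      (P := fun x : (Fin 3 × Fin 3) ⊕ Fin 3 → ℝ => ∀ (V : E3 →L[ℝ] E3) (η : E3), (∀ v v' : E3, ⟪V v, v'⟫ = ⟪v, V v'⟫) → ‖V - 1‖ ≤ 1 / 4 →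
        (∀ ab : Fin 3 × Fin 3, (V (EuclideanSpace.single ab.2 (1 : ℝ))) ab.1 = x (Sum.inl ab)) →
        (∀ i : Fin 3, η i = x (Sum.inr i) + (affShuf J c V - cenShuf c) i) → η 1 ≤ 0 → (η 0) ^ 2 ≤ 3 * (η 1) ^ 2 →
        (∀ (M : ℕ) (z : Fin M → E3) (cc : Fin M), Function.Injective z →
            Set.range z = {x : E3 | dist x (z cc) ≤ 133 / 10 ∧ ∃ a : Fin 3 → ℤ,
              x = z cc + latPt V hexFrame a ∨ x = z cc + latPt V hexFrame a + V (hcpShift + η)} →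
            TightNearCap (9 / 5) (3 / 2) z cc ∨ ExemptNear (9 / 5) ExRec z cc ∨ BadNearCap (9 / 5) (3 / 2) z cc) ∨
          (μ : ℝ) / SC ≤ ∑ b ∈ (Fintype.piFinset fun _ : Fin 3 => Finset.Icc (-7 : ℤ) 7).filter (fun b => b ≠ 0), effPot w₄₅ ω₄ (3 / 400) ‖latPt V hexFrame b‖ +
            ∑ b ∈ (Fintype.piFinset fun _ : Fin 3 => Finset.Icc (-7 : ℤ) 7), effPot w₄₅ ω₄ (3 / 400) ‖latPt V hexFrame b + V (hcpShift + η)‖)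
      (hullInner inner J c) (fun c' w' hv x hx' V η hVsa hV1 hVx hηx hb' hab' => by
        have hVb : ∀ ab : Fin 3 × Fin 3, |(V (EuclideanSpace.single ab.2 (1 : ℝ))) ab.1 - (c' (Sum.inl ab) : ℝ) / SC| ≤ (w' (Sum.inl ab) : ℝ) / SC :=
          fun ab => by rw [hVx ab]; exact hx' (Sum.inl ab)
        refine hinner (hullC J c c') (hullWd J w') hv V η hVsa hV1 (fun ab => hVb ab) (fun i => ?_) hb' hab'
        rw [hηx i]
        exact hull_point V hVb (hx' (Sum.inr i)))
      t c (htWr p c w) htree _ hx U ξ hsa hU (fun _ => rfl) (fun i => by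
        show ξ i = (c (Sum.inr i) : ℝ) / SC + (ξ - ξ₀) i + (affShuf J c U - cenShuf c) i
        rw [PiLp.sub_apply, PiLp.sub_apply, cenShuf_apply, hξ₀def]; ring) hb hab
    exact key
  exact hver_of_slabParts hU hn₀ hn B R hB hBin hR hcurv hf₀ hslab

/-! ## §3. Guarded re-validation of an evaluated slab certificate (R6) -/

/-- ★ (R6) An EVALUATED slab certificate over `inner₁`, plus the guard tree over `g` on the same sheet-tracked hull boxes, is a slab certificate over any
`inner₂` with `inner₁ ∧ g ⇒ inner₂` box-wise — the certificate side is untouched, the inner tree is transferred by `treeOK_of_guard`. [formal bookkeeping] -/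
theorem entryLeafOKHT4A2QS_of_guard {inner₁ g inner₂ : ((Fin 3 × Fin 3) ⊕ Fin 3 → ℤ) → ((Fin 3 × Fin 3) ⊕ Fin 3 → ℤ) → Bool}
    (himp : ∀ c w, inner₁ c w = true → g c w = true → inner₂ c w = true)
    {p : HTCert} {Q : Fin 3 → ℤ} {Gn : ℤ} {J : Fin 3 → Fin 3 × Fin 3 → ℤ} {t : CertTree ((Fin 3 × Fin 3) ⊕ Fin 3)} {c w : (Fin 3 × Fin 3) ⊕ Fin 3 → ℤ}
    (h : entryLeafOKHT4A2QS inner₁ p Q Gn J t c w = true) (hg : treeOK (hullInner g J c) t c (htWr p c w) = true) :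
    entryLeafOKHT4A2QS inner₂ p Q Gn J t c w = true := by
  unfold entryLeafOKHT4A2QS at h ⊢
  simp only [Bool.and_eq_true] at h ⊢
  exact ⟨h.1, treeOK_of_guard (v₁ := hullInner inner₁ J c) (g := hullInner g J c) (v₂ := hullInner inner₂ J c)
    (fun _ _ h1 h2 => himp _ _ h1 h2) t c (htWr p c w) h.2 hg⟩

/-- (R6, the implication specialised) old inner verdict of record ⇒ inner Σ-verdict under the guard `innerGuardQ`. [formal bookkeeping] -/
theorem entryLeafOKHT4A2QS_Q_of_guard {μ : ℤ} {q : Fin 4 → ℤ} {p : HTCert} {Q : Fin 3 → ℤ} {Gn : ℤ} {J : Fin 3 → Fin 3 × Fin 3 → ℤ}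
    {t : CertTree ((Fin 3 × Fin 3) ⊕ Fin 3)} {c w : (Fin 3 × Fin 3) ⊕ Fin 3 → ℤ} (h : entryLeafOKHT4A2QS (entryLeafOKHQDCRS μ q) p Q Gn J t c w = true)
    (hg : treeOK (hullInner innerGuardQ J c) t c (htWr p c w) = true) :
    entryLeafOKHT4A2QS (entryLeafOKHQDCRSQ μ q) p Q Gn J t c w = true :=
  entryLeafOKHT4A2QS_of_guard (fun c' w' h1 h2 => entryLeafOKHQDCRSQ_of_guard μ q c' w' h1 h2) h hg

/-! ## §4. The semantic facts in the quotient currency -/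

/-- ★ **A SHEET CELL CERTIFIED WITH EXPLICIT PAYLOADS by the slab leaf over the inner Σ-verdict is a `semOKHQ` fact at level `μ`** — the sign-free
production leaf of the quotient bookkeeping (one kernel evaluation per orbit of the twelve-element group). [formal bookkeeping] -/
theorem semOKHQ_of_A2QSQ {μ : ℤ} {q : Fin 4 → ℤ} {p : HTCert} {Q : Fin 3 → ℤ} {Gn : ℤ} {J : Fin 3 → Fin 3 × Fin 3 → ℤ}
    {t : CertTree ((Fin 3 × Fin 3) ⊕ Fin 3)} {c w : (Fin 3 × Fin 3) ⊕ Fin 3 → ℤ} (h : entryLeafOKHT4A2QS (entryLeafOKHQDCRSQ μ q) p Q Gn J t c w = true) :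
    semOKHQ μ c w = true :=
  semOKHQ_of_sound (entryLeafOKHT4A2QS (entryLeafOKHQDCRSQ μ q) p Q Gn J t)
    (fun _ _ hv U ξ hsa _ hU _ hbox hξ hb hab =>
      entryLeafOKHT4A2QS_soundQ (fun c₁ w₁ h₁ V η hVsa hV1 hVb hη hb₁ hab₁ => entryLeafOKHQDCRSQ_sound c₁ w₁ h₁ V η hVsa hV1 hVb hη hb₁ hab₁)
        hv U ξ hsa hU hbox hξ hb hab) h

/-- ★ (R6) **AN OLD CELL, RE-VALIDATED**: a cell certified by the slab leaf over the inner verdict OF RECORD, plus its (cheap) guard tree, is a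
`semOKHQ` fact — on the WHOLE box, both `ξ₂` halves, no sign. [formal bookkeeping] -/
theorem semOKHQ_of_A2QS_guard {μ : ℤ} {q : Fin 4 → ℤ} {p : HTCert} {Q : Fin 3 → ℤ} {Gn : ℤ} {J : Fin 3 → Fin 3 × Fin 3 → ℤ}
    {t : CertTree ((Fin 3 × Fin 3) ⊕ Fin 3)} {c w : (Fin 3 × Fin 3) ⊕ Fin 3 → ℤ} (h : entryLeafOKHT4A2QS (entryLeafOKHQDCRS μ q) p Q Gn J t c w = true)
    (hg : treeOK (hullInner innerGuardQ J c) t c (htWr p c w) = true) : semOKHQ μ c w = true :=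
  semOKHQ_of_A2QSQ (entryLeafOKHT4A2QS_Q_of_guard h hg)

/-! ## §5. Kernel smoke test: where the guard bites -/

/-- The `ξ₂ < 0` quarter of a worst-ray sheet cell at `t = 0.8 t_b` (`ξ`-centre `(0, −5.7e-3, −6.2e-4)`, entry part the quarter root box): the OLD
currency pruned it by sign (`shufOut` fires, the guard `innerGuardQ` refuses it) while it lies inside `Σ` (`sectorOut` does not fire) — under the
quotient verdict such boxes are certified for real, in exchange for the whole mirror-partner column. -/
example :
    shufOut (Function.update (Function.update (Function.update rootCHQ (Sum.inr 0) 0) (Sum.inr 1) (-1604000000000)) (Sum.inr 2) (-174500000000))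
        (Function.update (Function.update (Function.update rootWHQ (Sum.inr 0) 486951709709) (Sum.inr 1) 551690954353) (Sum.inr 2) 87300000000) = true ∧
      innerGuardQ (Function.update (Function.update (Function.update rootCHQ (Sum.inr 0) 0) (Sum.inr 1) (-1604000000000)) (Sum.inr 2) (-174500000000))
        (Function.update (Function.update (Function.update rootWHQ (Sum.inr 0) 486951709709) (Sum.inr 1) 551690954353) (Sum.inr 2) 87300000000) = false ∧
      sectorOut (Function.update (Function.update (Function.update rootCHQ (Sum.inr 0) 0) (Sum.inr 1) (-1604000000000)) (Sum.inr 2) (-174500000000))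
        (Function.update (Function.update (Function.update rootWHQ (Sum.inr 0) 486951709709) (Sum.inr 1) 551690954353) (Sum.inr 2) 87300000000) = false := by
  refine ⟨?_, ?_, ?_⟩ <;> decide +kernel

end Summit.AtomisticToContinuum.Crystallization.Theorems.FrustratedLawDichotomyStrainedPatchHomEntryLeafHT

end
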